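import Mathlib
import Summits.NavierStokesRegularity.NavierStokesRegularity.Theorems.SubOnsagerCeilingDefs
import Summits.NavierStokesRegularity.NavierStokesRegularity.Theorems.SubOnsagerCeilingOrthantTailCeilingDyadicRatioTwoTools
import Literature.Analysis.FluidPDE.Tao2016AveragedNS.RenormalisedCascadeWaves
import HarnessLib

/-!
# Route SubOnsagerCeiling — amplitude scaling: the one-mode item `DyadicTailCeiling` at one ratio gives the
# shell barrier for EVERY scaled dyadic table at that ratio
# (helper file, def-free; `--supports` the crux `ForwardTailCeilingKP`, stmt-NavierStokesRegularity-27057)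

Companion of `SubOnsagerCeilingDyadicTailCeilingLargeRatio.lean` (the direction «shell barrier for every
scaled dyadic table ⇒ body of `DyadicTailCeiling`»).  Here the converse: the body of the route item
`Theses.SubOnsagerCeiling.DyadicTailCeiling` (stmt-25511) at ONE scale ratio `1+ε₀` — a statement about the
table `dyadicTable` with coupling `c = 1` only — yields `ShellBarrierAt R ε₀ α` for EVERY scaled dyadic table
`α = c·dyadicTable`, `c > 0` (the chain corner of the registered stubs of `ForwardTailCeilingKP` in the exact
format of the LEAD's rungs), with the same exponent `θ` and `D = C`.

The mechanism is AMPLITUDE SCALING (no time change): the cascade nonlinearity is linear in the table and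
quadratic in the family (`quadTerm ε₀ (c·dyadicTable) X = c·quadTerm ε₀ dyadicTable X` — the landed
`dyadicRatioTwo_quadTerm_const_mul` —,
`quadTerm ε₀ dyadicTable (cX) = c²·quadTerm ε₀ dyadicTable X`), so along an honest `ν`-viscous solution `X` of
`c·dyadicTable` the family `Y = cX` is an honest `ν`-viscous solution of `dyadicTable` (same `ν`, datum `cX₀`,
same signs); the tail ceiling for `Y` at `n = N = k` is the weighted shell bound for `X` (the factor `c²`
cancels against `E₀(Y) = c²E₀(X)`).

* `dyadicScaling_quadTerm_state` — the quadratic homogeneity in the family (Fin 4 tables);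
* `dyadicScaling_hasDerivWithinAt` — `Y = cX` solves the `dyadicTable` lattice;
* **`shellBarrierAt_scaledDyadic_of_dyadicTailCeilingAt`** — body of `DyadicTailCeiling` at `ε₀` ⇒
  `∀ R, ∀ α, IsScaledDyadic α → ShellBarrierAt R ε₀ α`;
* `shellBarrierAt_scaledDyadic_of_dyadicTailCeiling` — from the route decl itself, at every `ε₀ ∈ (0,1]`.

So, together with the companion file, at every ratio «item 25511 at `ε₀`» and «the chain corner of both
stubs at `ε₀`» are the same statement up to constants.  HONEST FRAMING: bookkeeping on a MODEL lattice ODE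
(route SubOnsagerCeiling, rung TL-M2Break); conditional on an OPEN item; no stub, crux or summit is proved
here and nothing in this file bears on Navier–Stokes regularity.
[cite: Tao2016AveragedNS, §4 (4.8) (the quadratic nonlinearity), §1.2 (the dyadic Katz–Pavlović system)].
-/

noncomputable section

-- the sub-problem namespace `NavierStokesRegularity.NavierStokesRegularity` is the tree's layout (D-0017)
set_option linter.dupNamespace false

namespace Summit.NavierStokesRegularity.NavierStokesRegularity.Theorems

open Set
open Literature.Analysis.FluidPDE.TaoCascade
open Summit.NavierStokesRegularity.NavierStokesRegularity.Theses.SubOnsagerCeiling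
open Summit.NavierStokesRegularity.NavierStokesRegularity.Theorems.SubOnsagerCeiling

/-- `quadTerm` is quadratic in the family: `quadTerm ε₀ β (cX) = c² · quadTerm ε₀ β X`.
[cite: Tao2016AveragedNS, §4 (4.8)] -/
theorem dyadicScaling_quadTerm_state (ε₀ c : ℝ) (β : Fin 4 → Fin 4 → Fin 4 → ℤ × ℤ × ℤ → ℝ)
    (X : Fin 4 → ℤ → ℝ → ℝ) (i : Fin 4) (n : ℤ) (t : ℝ) :
    quadTerm ε₀ β (fun j k s => c * X j k s) i n t = c ^ 2 * quadTerm ε₀ β X i n t := by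
  simp only [quadTerm, Finset.mul_sum]
  refine Finset.sum_congr rfl fun i₁ _ => Finset.sum_congr rfl fun i₂ _ =>
    Finset.sum_congr rfl fun μ _ => ?_
  ring

/-- **Amplitude scaling of honest viscous solutions.** If `X` solves the `ν`-viscous lattice of the scaled
table `α = c·β` within `[0,s]`, then `Y = cX` solves the `ν`-viscous lattice of `β` within `[0,s]` (same
viscosity, no time change). [cite: Tao2016AveragedNS, §4 (4.8)] -/
theorem dyadicScaling_hasDerivWithinAt {ε₀ ν c s : ℝ} {α β : Fin 4 → Fin 4 → Fin 4 → ℤ × ℤ × ℤ → ℝ}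
    (h : ∀ (i₁ i₂ i₃ : Fin 4) (μ : ℤ × ℤ × ℤ), α i₁ i₂ i₃ μ = c * β i₁ i₂ i₃ μ)
    {X : Fin 4 → ℤ → ℝ → ℝ}
    (hode : ∀ (i : Fin 4) (k : ℤ), ∀ t ∈ Set.Icc (0 : ℝ) s, HasDerivWithinAt (X i k)
      (quadTerm ε₀ α X i k t - ν * (1 + ε₀) ^ ((2 : ℝ) * k) * X i k t) (Set.Icc (0 : ℝ) s) t) :
    ∀ (i : Fin 4) (k : ℤ), ∀ t ∈ Set.Icc (0 : ℝ) s, HasDerivWithinAt (fun r => c * X i k r)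
      (quadTerm ε₀ β (fun j l r => c * X j l r) i k t -
        ν * (1 + ε₀) ^ ((2 : ℝ) * k) * (c * X i k t)) (Set.Icc (0 : ℝ) s) t := by
  intro i k t ht
  have h2 : quadTerm ε₀ β (fun j l r => c * X j l r) i k t -
        ν * (1 + ε₀) ^ ((2 : ℝ) * k) * (c * X i k t)
      = c * (quadTerm ε₀ α X i k t - ν * (1 + ε₀) ^ ((2 : ℝ) * k) * X i k t) := by
    rw [dyadicScaling_quadTerm_state, dyadicRatioTwo_quadTerm_const_mul h]
    ring
  rw [h2]
  exact (hode i k t ht).const_mul c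

/-- **Body of `DyadicTailCeiling` at `ε₀` ⇒ `ShellBarrierAt R ε₀ α` for every scaled dyadic table** (any
spread parameter `R`; the table-class and orthant inputs of `ShellBarrierAt` are not used), with the same
`θ` and `D = C`: apply the ceiling to `Y = cX` (`dyadicScaling_hasDerivWithinAt`; datum `cX₀`, same signs,
decay bound `cM`) at `n = N = k` and cancel `c² > 0`. MODEL lattice statement. [this file] -/
theorem shellBarrierAt_scaledDyadic_of_dyadicTailCeilingAt {ε₀ : ℝ} (hε : 0 < ε₀)
    (h : ∃ θ : ℝ, 1 / 2 < θ ∧ ∃ C : ℝ, 0 ≤ C ∧ ∀ ν : ℝ, 0 < ν → ∀ (X₀ : Fin 4 → ℝ) (s : ℝ), 0 < s →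
      ∀ X : Fin 4 → ℤ → ℝ → ℝ, (∀ (i : Fin 4) (k : ℤ), X i k 0 = if k = 0 then X₀ i else 0) →
      (∀ (i : Fin 4) (k : ℤ), k < 0 → ∀ t : ℝ, X i k t = 0) →
      (∃ M : ℝ, ∀ (t : ℝ) (i : Fin 4) (k : ℤ), (1 + (1 + ε₀) ^ ((10 : ℝ) * k)) * |X i k t| ≤ M) →
      (∀ (i : Fin 4) (k : ℤ), Continuous (X i k)) →
      (∀ (i : Fin 4) (k : ℤ), ∀ t ∈ Set.Icc (0 : ℝ) s, HasDerivWithinAt (X i k)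
        (Literature.Analysis.FluidPDE.TaoCascade.quadTerm ε₀ Literature.Analysis.FluidPDE.TaoCascade.dyadicTable X i k t
          - ν * (1 + ε₀) ^ ((2 : ℝ) * k) * X i k t) (Set.Icc (0 : ℝ) s) t) →
      (∀ t ∈ Set.Icc (0 : ℝ) s, ∀ (i : Fin 4) (k : ℤ), 1 ≤ k → 0 ≤ X i k t) →
      ∀ n N : ℕ, n ≤ N → ∀ t ∈ Set.Icc (0 : ℝ) s,
        ∑ k ∈ Finset.Icc n N, ∑ i : Fin 4, (1 / 2 : ℝ) * X i (k : ℤ) t ^ 2 ≤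
          C * (∑ i : Fin 4, (1 / 2 : ℝ) * X₀ i ^ 2) * (1 + ε₀) ^ (-(2 * θ * (n : ℝ)))) :
    ∀ R : ℝ, ∀ α : Fin 4 → Fin 4 → Fin 4 → ℤ × ℤ × ℤ → ℝ, IsScaledDyadic α → ShellBarrierAt R ε₀ α := by
  intro R α hα _hT _hO
  obtain ⟨c, hc, hα⟩ := hα
  obtain ⟨θ, hθ, C, hC, hceil⟩ := h
  refine ⟨θ, hθ, C, hC, ?_⟩
  intro ν hν X₀ s hs X hdat hvan hbdd hcont hode hnn t ht i k
  have hb0 : (0 : ℝ) < 1 + ε₀ := by linarith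
  -- the scaled family `Y = cX` solves the `dyadicTable` lattice from the datum `cX₀`
  set Y : Fin 4 → ℤ → ℝ → ℝ := fun j l r => c * X j l r with hY
  have hYdat : ∀ (j : Fin 4) (l : ℤ), Y j l 0 = if l = 0 then (fun a => c * X₀ a) j else 0 := by
    intro j l
    simp only [hY, hdat j l]
    split_ifs <;> simp
  have hYvan : ∀ (j : Fin 4) (l : ℤ), l < 0 → ∀ r : ℝ, Y j l r = 0 := by
    intro j l hl r
    simp [hY, hvan j l hl r]
  have hYbdd : ∃ M : ℝ, ∀ (r : ℝ) (j : Fin 4) (l : ℤ), (1 + (1 + ε₀) ^ ((10 : ℝ) * l)) * |Y j l r| ≤ M := by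
    obtain ⟨M, hM⟩ := hbdd
    refine ⟨c * M, fun r j l => ?_⟩
    have := hM r j l
    have hw : 0 ≤ 1 + (1 + ε₀) ^ ((10 : ℝ) * l) := by positivity
    calc (1 + (1 + ε₀) ^ ((10 : ℝ) * l)) * |Y j l r|
        = c * ((1 + (1 + ε₀) ^ ((10 : ℝ) * l)) * |X j l r|) := by
          simp only [hY, abs_mul, abs_of_pos hc]; ring
      _ ≤ c * M := mul_le_mul_of_nonneg_left this hc.le
  have hYcont : ∀ (j : Fin 4) (l : ℤ), Continuous (Y j l) := fun j l => (hcont j l).const_mul c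
  have hYode := dyadicScaling_hasDerivWithinAt (ε₀ := ε₀) (ν := ν) (s := s) hα hode
  have hYnn : ∀ r ∈ Set.Icc (0 : ℝ) s, ∀ (j : Fin 4) (l : ℤ), 1 ≤ l → 0 ≤ Y j l r :=
    fun r hr j l hl => mul_nonneg hc.le (hnn r hr j l hl)
  have hc2 : 0 < c ^ 2 := by positivity
  -- the ceiling for `Y` at `n = N = k`
  have hk := hceil ν hν (fun a => c * X₀ a) s hs Y hYdat hYvan hYbdd hYcont hYode hYnn k k le_rfl t ht
  rw [Finset.Icc_self, Finset.sum_singleton] at hk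
  have hsingle : (1 / 2 : ℝ) * Y i (k : ℤ) t ^ 2 ≤ ∑ j : Fin 4, (1 / 2 : ℝ) * Y j (k : ℤ) t ^ 2 :=
    Finset.single_le_sum (f := fun j => (1 / 2 : ℝ) * Y j (k : ℤ) t ^ 2) (fun j _ => by positivity)
      (Finset.mem_univ i)
  have hE : (∑ j : Fin 4, (1 / 2 : ℝ) * (c * X₀ j) ^ 2) = c ^ 2 * ∑ j : Fin 4, (1 / 2 : ℝ) * X₀ j ^ 2 := by
    rw [Finset.mul_sum]
    exact Finset.sum_congr rfl fun j _ => by ring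
  have hYi : (1 / 2 : ℝ) * Y i (k : ℤ) t ^ 2 = c ^ 2 * ((1 / 2 : ℝ) * X i (k : ℤ) t ^ 2) := by
    simp only [hY]; ring
  have hmain : c ^ 2 * ((1 / 2 : ℝ) * X i (k : ℤ) t ^ 2) ≤
      c ^ 2 * (C * (∑ j : Fin 4, (1 / 2 : ℝ) * X₀ j ^ 2) * (1 + ε₀) ^ (-(2 * θ * (k : ℝ)))) := by
    calc c ^ 2 * ((1 / 2 : ℝ) * X i (k : ℤ) t ^ 2) = (1 / 2 : ℝ) * Y i (k : ℤ) t ^ 2 := hYi.symm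
      _ ≤ C * (∑ j : Fin 4, (1 / 2 : ℝ) * (c * X₀ j) ^ 2) * (1 + ε₀) ^ (-(2 * θ * (k : ℝ))) :=
          hsingle.trans hk
      _ = c ^ 2 * (C * (∑ j : Fin 4, (1 / 2 : ℝ) * X₀ j ^ 2) * (1 + ε₀) ^ (-(2 * θ * (k : ℝ)))) := by
          rw [hE]; ring
  have hX : (1 / 2 : ℝ) * X i (k : ℤ) t ^ 2 ≤
      C * (∑ j : Fin 4, (1 / 2 : ℝ) * X₀ j ^ 2) * (1 + ε₀) ^ (-(2 * θ * (k : ℝ))) :=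
    le_of_mul_le_mul_left hmain hc2
  have hw : 0 < (1 + ε₀) ^ (2 * θ * (k : ℝ)) := Real.rpow_pos_of_pos hb0 _
  have hinv : (1 + ε₀) ^ (2 * θ * (k : ℝ)) * (1 + ε₀) ^ (-(2 * θ * (k : ℝ))) = 1 := by
    rw [← Real.rpow_add hb0, add_neg_cancel, Real.rpow_zero]
  calc (1 + ε₀) ^ (2 * θ * (k : ℝ)) * ((1 / 2 : ℝ) * X i (k : ℤ) t ^ 2)
      ≤ (1 + ε₀) ^ (2 * θ * (k : ℝ)) *
          (C * (∑ j : Fin 4, (1 / 2 : ℝ) * X₀ j ^ 2) * (1 + ε₀) ^ (-(2 * θ * (k : ℝ)))) :=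
        mul_le_mul_of_nonneg_left hX hw.le
    _ = C * (∑ j : Fin 4, (1 / 2 : ℝ) * X₀ j ^ 2) *
          ((1 + ε₀) ^ (2 * θ * (k : ℝ)) * (1 + ε₀) ^ (-(2 * θ * (k : ℝ)))) := by ring
    _ = C * ∑ j : Fin 4, (1 / 2 : ℝ) * X₀ j ^ 2 := by rw [hinv, mul_one]

/-- **`DyadicTailCeiling` (item stmt-25511) ⇒ the chain corner of `ForwardTailCeilingKP` at every ratio**:
`ShellBarrierAt R ε₀ α` for every spread `R`, every `ε₀ ∈ (0,1]` and every scaled dyadic table `α`.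
Conditional on the open item; MODEL lattice statement. [this file] -/
theorem shellBarrierAt_scaledDyadic_of_dyadicTailCeiling (h : DyadicTailCeiling) :
    ∀ R : ℝ, ∀ ε₀ : ℝ, 0 < ε₀ → ε₀ ≤ 1 →
      ∀ α : Fin 4 → Fin 4 → Fin 4 → ℤ × ℤ × ℤ → ℝ, IsScaledDyadic α → ShellBarrierAt R ε₀ α :=
  fun R ε₀ h0 hle => shellBarrierAt_scaledDyadic_of_dyadicTailCeilingAt h0 (h ε₀ h0 hle) R

end Summit.NavierStokesRegularity.NavierStokesRegularity.Theorems

end
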